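import Summits.AtomisticToContinuum.Crystallization.Theses.PRVarianceCertificate

/-!
# `CoerciveToDefectVanish` (route PRVarianceCertificate, item stmt-AtomisticToContinuum-11866)

The glue `CoerciveVarianceCertificate → CrysEnergyUpper → CrysPeriodicBddBelow → BulkDefectVanish`.

Write, for a Lennard-Jones ground state `x` of `N ≥ 2` particles, `sᵢ = ∑_{j≠i} r_ij⁻⁶`,
`tᵢ = ∑_{j≠i} r_ij⁻¹²`, `S₁ = ∑ sᵢ`, `S₂ = ∑ sᵢ²`, `T = ∑ tᵢ`, `E = E(N)`, `a = E / N`.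
Then `2E = T/12 - S₁/6` (double counting), `S₁² ≤ N S₂` (Cauchy–Schwarz) and the certificate
`c·#bad ≤ C T - S₂` give, by the polynomial identity
`N² C (C + 24 a) - (N C T - S₁²) = (S₁ - N C)²`,
the bound `c·#bad ≤ N C (C + 24 a) ≤ 24 N C (a - e(P))` (using `e(P) ≤ -C/24`).
Hence `#bad/N ≤ (24C/c)(E(N)/N - e(P))` and `E(N)/N ≥ e(P)`; with Blanc–Lewin (8)
(`E(N)/N → e`), `CrysEnergyUpper` and `ciInf_le` one gets `e = e(P)`, and the squeeze finishes.
No minimal-distance input is needed.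
-/

namespace Summit.AtomisticToContinuum.Crystallization.Theorems

open Filter Topology
open Literature.MathematicalPhysics.StatisticalMechanics
open Summit.AtomisticToContinuum.Crystallization.Theses.PRVarianceCertificate

/-- The Lennard-Jones site energy splits as `(1/12)·tᵢ - (1/6)·sᵢ`. -/
theorem siteEnergy_lennardJones_eq_inv_pow {d N : ℕ} (x : Fin N → EuclideanSpace ℝ (Fin d))
    (i : Fin N) :
    siteEnergy lennardJones x i =
      (1 / 12) * siteEnergy (fun r => (r⁻¹) ^ 12) x i
        - (1 / 6) * siteEnergy (fun r => (r⁻¹) ^ 6) x i := by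
  simp only [siteEnergy, lennardJones, Finset.sum_sub_distrib, Finset.mul_sum]

/-- Double counting for Lennard-Jones: `2 E = T/12 - S₁/6`. -/
theorem two_mul_interactionEnergy_lennardJones_eq_inv_pow {d N : ℕ}
    (x : Fin N → EuclideanSpace ℝ (Fin d)) :
    2 * interactionEnergy lennardJones x =
      (∑ i, siteEnergy (fun r => (r⁻¹) ^ 12) x i) / 12
        - (∑ i, siteEnergy (fun r => (r⁻¹) ^ 6) x i) / 6 := by
  rw [two_mul_interactionEnergy]
  simp only [siteEnergy_lennardJones_eq_inv_pow, Finset.sum_sub_distrib, ← Finset.mul_sum]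
  ring

/-- The deficit algebra: from the certificate `c·b ≤ C T - S₂`, Cauchy–Schwarz `S₁² ≤ N S₂`,
double counting `2 N a = T/12 - S₁/6` and `e ≤ -C/24` one gets `b/N ≤ (24C/c)(a - e)`
(the identity `N² C (C + 24a) - (N C T - S₁²) = (S₁ - N C)²`). -/
theorem deficit_count_div_le {N C c T S₁ S₂ b a e : ℝ} (hN : 0 < N) (hC : 0 ≤ C) (hc : 0 < c)
    (he : e ≤ -(C / 24)) (hcert : c * b ≤ C * T - S₂) (hCS : S₁ ^ 2 ≤ N * S₂)
    (hE : 2 * (N * a) = T / 12 - S₁ / 6) : b / N ≤ 24 * C / c * (a - e) := by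
  have hT : T = 24 * (N * a) + 2 * S₁ := by linarith
  have h1 : N * (C * T) - S₁ ^ 2 ≤ N * (N * C * (C + 24 * a)) := by
    have hid : N * (N * C * (C + 24 * a)) - (N * (C * T) - S₁ ^ 2) = (S₁ - N * C) ^ 2 := by
      rw [hT]; ring
    nlinarith [sq_nonneg (S₁ - N * C)]
  have h2 : N * (c * b) ≤ N * (N * C * (C + 24 * a)) := by
    have := mul_le_mul_of_nonneg_left hcert hN.le
    nlinarith
  have h3 : c * b ≤ N * C * (C + 24 * a) := le_of_mul_le_mul_left h2 hN
  have h4 : c * b ≤ 24 * N * C * (a - e) := by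
    have : N * C * (C + 24 * a) ≤ N * C * (24 * (a - e)) :=
      mul_le_mul_of_nonneg_left (by linarith) (mul_nonneg hN.le hC)
    linarith
  have h5 : b ≤ 24 * N * C * (a - e) / c := by
    rw [le_div_iff₀ hc]; linarith
  calc b / N ≤ 24 * N * C * (a - e) / c / N := div_le_div_of_nonneg_right h5 hN.le
    _ = 24 * C / c * (a - e) := by
      field_simp

/-- **Item stmt-AtomisticToContinuum-11866.** The coercive variance certificate, the trial-state
upper bound and the boundedness below of periodic energies imply that bulk defects vanish along
every sequence of Lennard-Jones ground states. -/
theorem coerciveToDefectVanish_proof : CoerciveToDefectVanish := by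
  unfold CoerciveToDefectVanish
  intro hCo hUp hBdd
  obtain ⟨P, C, hC, heP, hcoer⟩ := hCo
  refine ⟨P, ?_⟩
  intro R ε hR hε x hx
  obtain ⟨c, hc, hcert⟩ := hcoer R ε hR hε
  -- Step 1: the per-`N` deficit bound, for any count `b` certified by `hcert`.
  have key : ∀ N : ℕ, 2 ≤ N → ∀ b : ℝ,
      c * b ≤ C * ∑ i, siteEnergy (fun r => (r⁻¹) ^ 12) (x N) i
        - ∑ i, (siteEnergy (fun r => (r⁻¹) ^ 6) (x N) i) ^ 2 →
      b / N ≤ 24 * C / c *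
        (groundStateEnergy lennardJones 3 N / N - P.energyPerParticle lennardJones) := by
    intro N hN b hb
    have hN0 : 0 < N := by omega
    have hN' : (0 : ℝ) < N := by exact_mod_cast hN0
    have hE := two_mul_interactionEnergy_lennardJones_eq_inv_pow (x N)
    rw [(hx N).2] at hE
    have hNa : (N : ℝ) * (groundStateEnergy lennardJones 3 N / N) =
        groundStateEnergy lennardJones 3 N := by
      field_simp
    rw [← hNa] at hE
    have hCS := sq_sum_le_card_mul_sum_sq (s := (Finset.univ : Finset (Fin N)))
      (f := fun i => siteEnergy (fun r => (r⁻¹) ^ 6) (x N) i)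
    simp only [Finset.card_univ, Fintype.card_fin] at hCS
    exact deficit_count_div_le hN' hC.le hc heP hb hCS hE
  -- Step 2: `E(N)/N → e(P)`.
  obtain ⟨e, -, hlim, -⟩ := BlancLewin2015_8_holds 3 (by norm_num) (by norm_num)
  have hge : P.energyPerParticle lennardJones ≤ e := by
    refine ge_of_tendsto hlim ((eventually_ge_atTop 2).mono fun N hN => ?_)
    have hb := key N hN _ (hcert N (x N) (hx N) hN)
    have h0 : (0 : ℝ) ≤ 24 * C / c *
        (groundStateEnergy lennardJones 3 N / N - P.energyPerParticle lennardJones) :=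
      le_trans (div_nonneg (Nat.cast_nonneg _) (Nat.cast_nonneg _)) hb
    have hpos : (0 : ℝ) < 24 * C / c := by positivity
    have := (mul_nonneg_iff_of_pos_left hpos).1 h0
    linarith
  have hle : e ≤ P.energyPerParticle lennardJones := by
    have h0 : CrysEnergyUpper := hUp
    unfold CrysEnergyUpper at h0
    rw [hlim.limsup_eq] at h0
    exact h0.trans (ciInf_le hBdd P)
  have heq : e = P.energyPerParticle lennardJones := le_antisymm hle hge
  -- Step 3: squeeze.
  have hg : Tendsto (fun N : ℕ => 24 * C / c *
      (groundStateEnergy lennardJones 3 N / N - P.energyPerParticle lennardJones))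
      atTop (𝓝 0) := by
    have := (hlim.sub_const (P.energyPerParticle lennardJones)).const_mul (24 * C / c)
    rwa [heq, sub_self, mul_zero] at this
  refine squeeze_zero' (Eventually.of_forall fun N => div_nonneg (Nat.cast_nonneg _) (Nat.cast_nonneg _))
    ((eventually_ge_atTop 2).mono fun N hN => ?_) hg
  exact key N hN _ (hcert N (x N) (hx N) hN)

end Summit.AtomisticToContinuum.Crystallization.Theorems
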